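import Summits.HodgeConjecture.HodgeConjecture.Theorems.Ring2BindersAbelianSchemeVHCSection
import Summits.HodgeConjecture.HodgeConjecture.Theorems.AnchorTransportVariationalHodgeCurveBase
import Summits.HodgeConjecture.HodgeConjecture.Theorems.Ring2DeformCompactPencils
import Literature.AlgebraicGeometry.Motives.CurveThroughTwoPointsProofs
import HarnessLib

/-!
# Ring 2 — binder seat b02 (Hodge ladder stage 3): row b02 `AbelianSchemeVHC` IS the variational Hodge statement
# for ONE-PARAMETER ABELIAN SCHEMES — families with a section over smooth irreducible affine CURVES

HONEST FRAMING: research route conditional on HC_CM; not a corollary; Q11.4-sentence-2 already refuted in dim ≥ 3.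

Cell `pub-hodge-ring2`, Hodge ladder stage 3, binder seat `ring2-b02`, row b02 of `BINDER-OWNERS.md` (the named
hypothesis `Ring2.Hypotheses.AbelianSchemeVHC`, `Theorems/Ring2Hypotheses.lean`:140; OPEN, print-equivalent to `HC_AV`,
nothing to discharge). `HC_CM` is not mentioned in any statement below; nothing here is a case of the Hodge conjecture;
no definition, no `sorry`, and no Literature named fact as hypothesis outside §4, whose single theorem (C4) displays
the two refereed André-1996 facts `andre1996_cmAnchoredPencil` (row c11 of `BINDER-OWNERS.md`) and
`andre1996_cmHodgeClasses_algebraicallyAnchoredPencils` (row c12) as binders `h₂₁`, `h₂₂` — consumed, never asserted;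
nothing is discharged and no number of `BINDER-OWNERS.md` moves.

This part composes the two UNCONDITIONAL reductions of row b02 now in the tree —
(i) the AnchorTransport route's reduction of the variational Hodge statement to smooth irreducible affine CURVE bases
for any base-change-stable class of families (`Theorems.variationalHodge_of_curveBase_of_stable`, driven by Mumford's
curve lemma, PROVED in the tree: `Motives.mumford_smoothCurve_through_two_points_holds`), applied to the class
"all complex fibres abelian AND a section exists" (both clauses pull back along any base change:
`abelianFibres_familyPullback`, `exists_section_familyPullback`), and
(ii) this seat's étale localisation `abelianSchemeVHC_of_section` (`Ring2BindersAbelianSchemeVHCSection.lean`: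
row b02 ⟸ row b02 for families WITH A SECTION over affine bases; EGA IV₄ 17.16.3 + SGA 1 XII 2.4 / 3.1 (iii)) —
into:

* (C1) `abelianSchemeVHC_of_sectionCurve`, (C1′) `abelianSchemeVHC_iff_sectionCurve` — **row b02 `AbelianSchemeVHC`
  (section-free, all smooth irreducible bases) ⟺ the variational Hodge statement for abelian-fibred smooth projective
  families WITH A SECTION over smooth irreducible AFFINE CURVES** (`topologicalKrullDim S = 1`): one-parameter
  abelian schemes [cite: MumfordGIT, Thm. 6.14] / [cite: LaurentSchroer2023, Prop. 4.3]. Unconditional.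
* (C2) `abelianSchemeVHC_of_germCurve_of_abelianSectionCurveQuasiProjective`, (C2′) `…_iff_…` — **EXACTNESS: row b02 ⟺
  its GERM form on one-parameter abelian schemes with quasi-projective total space** (one algebraic fibre of a
  fibrewise-Hodge global class forces a non-empty Euclidean-open set of algebraic fibres — the output shape of every
  deformation-theoretic engine over a one-dimensional base), **modulo the one residual
  `AbelianSectionCurveQuasiProjective[]`**: the total space of an abelian-fibred smooth proper family WITH A SECTION
  over a smooth irreducible affine CURVE is quasi-projective — in print: an abelian scheme (the section gives the group
  law, [cite: LaurentSchroer2023, Prop. 4.3]) over a normal noetherian base, a fortiori over a Dedekind scheme, is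
  projective over it [cite: GortzWedhorn2023, Thm. 27.291] (after Raynaud 1970, LNM 119 [cite: Raynaud1970, as cited by GortzWedhorn2023 Ch. 27; primary text not held, acq-09263]). The density step is
  the tree's `WeilTypeLadder.mem_algebraicClasses_of_isOpen_subset_algebraicityLocus` (Charles–Schnell's countable
  union of algebraicity loci + Baire + Mumford). `abelianSectionCurveQuasiProjective_of_abelianSectionQuasiProjective`:
  the curve residual is implied by the affine one of `Ring2BindersAbelianSchemeVHCSection.lean` (itself implied by the
  section-free one of `Ring2BindersAbelianSchemeVHCLocal.lean`).
* (C3) `abelianSchemeVHC_of_variationalHodgeQP_of_abelianSectionCurveQuasiProjective` — part XXVII's printed-carrier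
  node `VariationalHodgeQP` reaches row b02 granted only the curve residual.
* (C4) `hc_av_iff_abelianSchemeVHCSectionCurve_of_andre1996` — composing (C1′) with deform IV's (E₂′)
  `Deform.HC_AV_iff_abelianSchemeVHC_of_andre1996`: **`HC_AV` ⟺ the variational Hodge statement for one-parameter
  abelian schemes, modulo the two refereed André-1996 facts (Lemme 6.3.1; Lemmes 6.3.2–6.3.3) only** — no `HC_CM`,
  no residual.

So row b02 AS TYPED is, unconditionally, a statement about PROPER one-parameter abelian schemes; and modulo the
projectivity of such schemes (print) it is exactly the local density statement (C2′) that Bloch 1972 Thm. 7.4 /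
Buchweitz–Flenner 2003 Thm. 5.1-type engines output over a one-dimensional base.

What is NOT claimed: the residual; any case of `AbelianSchemeVHC`; anything about `HC_AV` or `HC_CM` (row b02 stays
OPEN ≡ `HC_AV` modulo print; «10 · 0» untouched).

References: [MumfordAV1970] §6 Lemma (curve through two points; PROVED in the tree); [Andre1996Motifs] §6.3; [Grothendieck1967] EGA IV₄
Cor. 17.16.3 (ii); [SGA1] Exp. XII Prop. 2.4, 3.1 (iii); [CharlesSchnell2014Notes] Conj. 11.3.1, proof of Prop. 11.3.11;
[MumfordGIT] Thm. 6.14; [LaurentSchroer2023] Prop. 4.3; [GortzWedhorn2023] Thm. 27.291; [Raynaud1970] (after Görtz–Wedhorn's attribution; not re-opened);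
[Bloch1972Semiregularity] Thm. 7.4; [BuchweitzFlenner2003] Thm. 5.1.
-/

-- every declaration of this problem lives in `Summit.HodgeConjecture.HodgeConjecture.…` (summit = sub-problem);
-- namespace `…Ring2.Binders` = the binder seats of the cell's Hodge-ladder stage 3 (`BINDER-OWNERS.md`)
set_option linter.dupNamespace false

noncomputable section

open CategoryTheory CategoryTheory.Limits AlgebraicGeometry Topology
open Literature.AlgebraicGeometry Literature.AlgebraicGeometry.Motives
open Literature.AlgebraicGeometry.HodgeTheory
open Literature.AlgebraicGeometry.Andre1996 (andre1996_cmAnchoredPencil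
  andre1996_cmHodgeClasses_algebraicallyAnchoredPencils)

namespace Summit.HodgeConjecture.HodgeConjecture.Ring2.Binders

open Summit.HodgeConjecture.HodgeConjecture.Ring2.Hypotheses

/-- `AbelianSchemeVHCSectionAffine[]` — verbatim from `Ring2BindersAbelianSchemeVHCSection.lean`: row b02 restricted
to smooth irreducible AFFINE bases and to families admitting a SECTION. Local notation only. -/
local notation3 (prettyPrint := false) "AbelianSchemeVHCSectionAffine[]" =>
  ∀ ⦃n : ℕ⦄ ⦃𝒳 S : SchemeOver ℂ⦄ (f : 𝒳 ⟶ S), IsSmoothProjectiveFamily f n → IrreducibleSpace S.left →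
    IsAffine S.left → AlgebraicGeometry.Smooth S.hom →
    (∀ s : ComplexPoints S, ∃ A' : AbelianVariety ℂ, A'.dim = n ∧ Nonempty (A'.X ≅ fiberOver f s)) →
    (∃ e : S ⟶ 𝒳, e ≫ f = 𝟙 S) →
    ∀ (p : ℕ) (W : complexBetti 𝒳 (2 * p)),
      (∀ s : ComplexPoints S, IsRationalClass (complexBetti.map (fiberι f s) (2 * p) W) ∧
        IsOfHodgeType n (fiberOver f s) (2 * p) p p (complexBetti.map (fiberι f s) (2 * p) W)) →
      (∃ s₀ : ComplexPoints S,
        complexBetti.map (fiberι f s₀) (2 * p) W ∈ algebraicClasses (fiberOver f s₀) p) →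
      ∀ s : ComplexPoints S, complexBetti.map (fiberι f s) (2 * p) W ∈ algebraicClasses (fiberOver f s) p

/-- `AbelianSchemeVHCSectionCurve[]` — row b02 restricted to ONE-PARAMETER ABELIAN SCHEMES: abelian-fibred smooth
projective families WITH A SECTION over smooth irreducible affine `ℂ`-schemes of topological Krull dimension `1`
(symbol for symbol `AbelianSchemeVHCSectionAffine[]` plus the clause `topologicalKrullDim S.left = 1`). Local notation
only (no definition is introduced). -/
local notation3 (prettyPrint := false) "AbelianSchemeVHCSectionCurve[]" =>
  ∀ ⦃n : ℕ⦄ ⦃𝒳 S : SchemeOver ℂ⦄ (f : 𝒳 ⟶ S), IsSmoothProjectiveFamily f n → IrreducibleSpace S.left →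
    IsAffine S.left → AlgebraicGeometry.Smooth S.hom → topologicalKrullDim S.left = 1 →
    (∀ s : ComplexPoints S, ∃ A' : AbelianVariety ℂ, A'.dim = n ∧ Nonempty (A'.X ≅ fiberOver f s)) →
    (∃ e : S ⟶ 𝒳, e ≫ f = 𝟙 S) →
    ∀ (p : ℕ) (W : complexBetti 𝒳 (2 * p)),
      (∀ s : ComplexPoints S, IsRationalClass (complexBetti.map (fiberι f s) (2 * p) W) ∧
        IsOfHodgeType n (fiberOver f s) (2 * p) p p (complexBetti.map (fiberι f s) (2 * p) W)) →
      (∃ s₀ : ComplexPoints S,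
        complexBetti.map (fiberι f s₀) (2 * p) W ∈ algebraicClasses (fiberOver f s₀) p) →
      ∀ s : ComplexPoints S, complexBetti.map (fiberι f s) (2 * p) W ∈ algebraicClasses (fiberOver f s) p

/-- `AbelianSchemeVHCGermCurve[]` — the GERM form of row b02 on one-parameter abelian schemes with engine-ready
carriers: abelian-fibred smooth projective families with QUASI-PROJECTIVE total space AND A SECTION over smooth
irreducible affine CURVES; one algebraic fibre of a fibrewise rational `(p,p)` global class forces a non-empty
Euclidean-open set of algebraic fibres around it (the output shape of Bloch 1972 Thm. 7.4 / Buchweitz–Flenner 2003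
Thm. 5.1 over a one-dimensional base). OPEN as a blanket statement; a HYPOTHESIS below, never asserted. Local
notation only. -/
local notation3 (prettyPrint := false) "AbelianSchemeVHCGermCurve[]" =>
  ∀ ⦃n : ℕ⦄ ⦃𝒳 S : SchemeOver ℂ⦄ (f : 𝒳 ⟶ S), IsSmoothProjectiveFamily f n → IsQuasiProjectiveOver 𝒳 →
    IrreducibleSpace S.left → IsAffine S.left → AlgebraicGeometry.Smooth S.hom → topologicalKrullDim S.left = 1 →
    (∀ s : ComplexPoints S, ∃ A' : AbelianVariety ℂ, A'.dim = n ∧ Nonempty (A'.X ≅ fiberOver f s)) →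
    (∃ e : S ⟶ 𝒳, e ≫ f = 𝟙 S) →
    ∀ (p : ℕ) (W : complexBetti 𝒳 (2 * p)),
      (∀ s : ComplexPoints S, IsRationalClass (complexBetti.map (fiberι f s) (2 * p) W) ∧
        IsOfHodgeType n (fiberOver f s) (2 * p) p p (complexBetti.map (fiberι f s) (2 * p) W)) →
      ∀ s₀ : ComplexPoints S,
        complexBetti.map (fiberι f s₀) (2 * p) W ∈ algebraicClasses (fiberOver f s₀) p →
        ∃ U : Set (ComplexPoints S), IsOpen U ∧ s₀ ∈ U ∧
          ∀ s ∈ U, complexBetti.map (fiberι f s) (2 * p) W ∈ algebraicClasses (fiberOver f s) p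

/-- `AbelianSchemeVHCGermAffine[]` — verbatim the germ form of row b02 of `Ring2BindersAbelianSchemeVHCLocal.lean`
(affine bases of any dimension, no section). A HYPOTHESIS below, never asserted. Local notation only. -/
local notation3 (prettyPrint := false) "AbelianSchemeVHCGermAffine[]" =>
  ∀ ⦃n : ℕ⦄ ⦃𝒳 S : SchemeOver ℂ⦄ (f : 𝒳 ⟶ S), IsSmoothProjectiveFamily f n → IsQuasiProjectiveOver 𝒳 →
    IrreducibleSpace S.left → IsAffine S.left → AlgebraicGeometry.Smooth S.hom →
    (∀ s : ComplexPoints S, ∃ A' : AbelianVariety ℂ, A'.dim = n ∧ Nonempty (A'.X ≅ fiberOver f s)) →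
    ∀ (p : ℕ) (W : complexBetti 𝒳 (2 * p)),
      (∀ s : ComplexPoints S, IsRationalClass (complexBetti.map (fiberι f s) (2 * p) W) ∧
        IsOfHodgeType n (fiberOver f s) (2 * p) p p (complexBetti.map (fiberι f s) (2 * p) W)) →
      ∀ s₀ : ComplexPoints S,
        complexBetti.map (fiberι f s₀) (2 * p) W ∈ algebraicClasses (fiberOver f s₀) p →
        ∃ U : Set (ComplexPoints S), IsOpen U ∧ s₀ ∈ U ∧
          ∀ s ∈ U, complexBetti.map (fiberι f s) (2 * p) W ∈ algebraicClasses (fiberOver f s) p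

/-- `AbelianSectionQuasiProjective[]` — verbatim the with-section residual of `Ring2BindersAbelianSchemeVHCSection.lean`
(affine bases of any dimension). A HYPOTHESIS below, never asserted. Local notation only. -/
local notation3 (prettyPrint := false) "AbelianSectionQuasiProjective[]" =>
  ∀ ⦃n : ℕ⦄ ⦃𝒳 S : SchemeOver ℂ⦄ (f : 𝒳 ⟶ S), IsSmoothProjectiveFamily f n → IrreducibleSpace S.left →
    IsAffine S.left → AlgebraicGeometry.Smooth S.hom →
    (∀ s : ComplexPoints S, ∃ A' : AbelianVariety ℂ, A'.dim = n ∧ Nonempty (A'.X ≅ fiberOver f s)) →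
    (∃ e : S ⟶ 𝒳, e ≫ f = 𝟙 S) → IsQuasiProjectiveOver 𝒳

/-- `AbelianSectionCurveQuasiProjective[]` — THE RESIDUAL of this file, the with-section residual WEAKENED to curve
bases: the total space of an abelian-fibred smooth proper family `f : 𝒳 ⟶ S` WITH A SECTION over a smooth irreducible
affine `ℂ`-scheme of topological Krull dimension `1` is quasi-projective over `ℂ`. In print: a one-parameter abelian
scheme (group law from the section, [cite: LaurentSchroer2023, Prop. 4.3]; [cite: MumfordGIT, Thm. 6.14] for
projective `f`) over a normal noetherian — here Dedekind — base is projective over it [cite: GortzWedhorn2023, Thm. 27.291]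
(after Raynaud 1970, LNM 119 [cite: Raynaud1970, as cited by GortzWedhorn2023 Ch. 27; primary text not held, acq-09263]); projective over an affine `ℂ`-curve is quasi-projective over `ℂ`. Not proved in
the tree; a HYPOTHESIS below, never asserted. Local notation only. -/
local notation3 (prettyPrint := false) "AbelianSectionCurveQuasiProjective[]" =>
  ∀ ⦃n : ℕ⦄ ⦃𝒳 S : SchemeOver ℂ⦄ (f : 𝒳 ⟶ S), IsSmoothProjectiveFamily f n → IrreducibleSpace S.left →
    IsAffine S.left → AlgebraicGeometry.Smooth S.hom → topologicalKrullDim S.left = 1 →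
    (∀ s : ComplexPoints S, ∃ A' : AbelianVariety ℂ, A'.dim = n ∧ Nonempty (A'.X ≅ fiberOver f s)) →
    (∃ e : S ⟶ 𝒳, e ≫ f = 𝟙 S) → IsQuasiProjectiveOver 𝒳

/-! ## §0 Sections pull back -/

/-- **A section of `f : 𝒳 ⟶ S` pulls back to a section of the base change `𝒳 ×_S S' ⟶ S'`** along any `g : S' ⟶ S`
(`(g ≫ e, 𝟙)` into the fibre product; Hartshorne II.3). [folklore] -/
theorem exists_section_familyPullback {𝒳 S S' : SchemeOver ℂ} (f : 𝒳 ⟶ S) (g : S' ⟶ S)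
    (h : ∃ e : S ⟶ 𝒳, e ≫ f = 𝟙 S) :
    ∃ e' : S' ⟶ familyPullback f g, e' ≫ familyPullback.snd f g = 𝟙 S' := by
  obtain ⟨e, he⟩ := h
  have hcomm : (g.left ≫ e.left) ≫ f.left = 𝟙 _ ≫ g.left := by
    rw [Category.assoc, ← Over.comp_left, he, Over.id_left, Category.comp_id, Category.id_comp]
  have hcond : pullback.lift (g.left ≫ e.left) (𝟙 _) hcomm ≫ pullback.fst f.left g.left ≫ 𝒳.hom = S'.hom := by
    rw [← Category.assoc, pullback.lift_fst, Category.assoc, Over.w e, Over.w g]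
  refine ⟨Over.homMk (pullback.lift (g.left ≫ e.left) (𝟙 _) hcomm) hcond, ?_⟩
  ext : 1
  exact pullback.lift_snd _ _ _

/-! ## §1 Row b02 reduces to one-parameter abelian schemes -/

/-- **(C1) Row b02 reduces to families WITH A SECTION over smooth irreducible affine CURVES.** Reduce to families with
a section over affine bases (`abelianSchemeVHC_of_section`, étale localisation), then to curve bases by the
AnchorTransport route's base-change-stable curve reduction (`Theorems.variationalHodge_of_curveBase_of_stable`, with
Mumford's lemma supplied by the tree theorem `Motives.mumford_smoothCurve_through_two_points_holds`) for the class of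
families "all complex fibres abelian and a section exists" (`abelianFibres_familyPullback`,
`exists_section_familyPullback`). Unconditional. [cite: MumfordAV1970, §6, Lemma]
[cite: Grothendieck1967, EGA IV₄ Cor. 17.16.3 (ii)] [cite: CharlesSchnell2014Notes, Conj. 11.3.1] -/
theorem abelianSchemeVHC_of_sectionCurve (h : AbelianSchemeVHCSectionCurve[]) : AbelianSchemeVHC :=
  abelianSchemeVHC_of_section fun _ _ _ f hf hirr _ hsm habel he p W hW h₀ s =>
    Theorems.variationalHodge_of_curveBase_of_stable mumford_smoothCurve_through_two_points_holds
      (fun 𝒳' S' f' => (∀ s' : ComplexPoints S', ∃ A' : AbelianVariety ℂ, Nonempty (A'.X ≅ fiberOver f' s')) ∧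
        ∃ e' : S' ⟶ 𝒳', e' ≫ f' = 𝟙 S')
      (fun _ _ _ f' g hQ => ⟨abelianFibres_familyPullback f' g hQ.1, exists_section_familyPullback f' g hQ.2⟩)
      (fun _ _ _ f' hf' hQ hirr' haff' hsm' hdim p' A hA hs₀ s' =>
        h f' hf' hirr' haff' hsm' hdim ((abelianFibres_iff_of_isSmoothProjectiveFamily hf').2 hQ.1) hQ.2 p' A hA
          hs₀ s')
      f hf ⟨(abelianFibres_iff_of_isSmoothProjectiveFamily hf).1 habel, he⟩ hirr hsm p W hW h₀ s

/-- Restriction: row b02 gives its curve-base-with-section form (forget the three clauses). [folklore] -/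
theorem abelianSchemeVHCSectionCurve_of_abelianSchemeVHC (h : AbelianSchemeVHC) : AbelianSchemeVHCSectionCurve[] :=
  fun _ _ _ f hf hirr _ hsm _ habel _ p W hW h₀ s => h f hf hirr hsm habel p W hW h₀ s

/-- **(C1′) EXACTNESS: row b02 `AbelianSchemeVHC` IS the variational Hodge statement for one-parameter abelian schemes**
(families with a section over smooth irreducible affine curves). Unconditional. [cite: MumfordAV1970, §6, Lemma]
[cite: Grothendieck1966, footnote 13] [cite: CharlesSchnell2014Notes, Conj. 11.3.1]
[cite: Deligne1982HodgeCycles, Milne 2003 re-edition endnote 19] -/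
theorem abelianSchemeVHC_iff_sectionCurve : AbelianSchemeVHC ↔ AbelianSchemeVHCSectionCurve[] :=
  ⟨abelianSchemeVHCSectionCurve_of_abelianSchemeVHC, abelianSchemeVHC_of_sectionCurve⟩

/-- The curve-base form with a section is implied by the affine-base form with a section (forget the dimension
clause). [folklore] -/
theorem abelianSchemeVHCSectionCurve_of_sectionAffine (h : AbelianSchemeVHCSectionAffine[]) :
    AbelianSchemeVHCSectionCurve[] :=
  fun _ _ _ f hf hirr haff hsm _ habel he p W hW h₀ s => h f hf hirr haff hsm habel he p W hW h₀ s

/-! ## §2 LOCAL ⟹ GLOBAL on one-parameter abelian schemes, modulo their projectivity -/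

/-- The curve residual is implied by the affine with-section residual (forget the dimension clause). [folklore] -/
theorem abelianSectionCurveQuasiProjective_of_abelianSectionQuasiProjective (h : AbelianSectionQuasiProjective[]) :
    AbelianSectionCurveQuasiProjective[] :=
  fun _ _ _ f hf hirr haff hsm _ habel he => h f hf hirr haff hsm habel he

/-- **(C2) Row b02 from its GERM form on one-parameter abelian schemes, granted only the curve residual.** Reduce to
families with a section over affine curves (C1); there the total space is quasi-projective by the residual and the
base is quasi-projective (`IsQuasiProjectiveOver.of_isAffine`); the germ hypothesis gives a non-empty Euclidean-open
set of algebraic fibres around the anchor, whence every fibre is algebraic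
(`WeilTypeLadder.mem_algebraicClasses_of_isOpen_subset_algebraicityLocus`: countable union of Zariski-closed
algebraicity loci, Baire, Mumford's curve lemma — tree theorems). [cite: CharlesSchnell2014Notes, Prop. 11.3.11 (proof)]
[cite: MumfordAV1970, §6, Lemma] [cite: LaurentSchroer2023, Prop. 4.3] [cite: GortzWedhorn2023, Thm. 27.291] -/
theorem abelianSchemeVHC_of_germCurve_of_abelianSectionCurveQuasiProjective
    (hqp : AbelianSectionCurveQuasiProjective[]) (hG : AbelianSchemeVHCGermCurve[]) : AbelianSchemeVHC :=
  abelianSchemeVHC_of_sectionCurve fun _ _ S f hf hirr haff hsm hdim habel he p W hW h₀ s => by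
    obtain ⟨s₀, hs₀⟩ := h₀
    have h𝒳 := hqp f hf hirr haff hsm hdim habel he
    obtain ⟨U, hUo, hs₀U, hUalg⟩ := hG f hf h𝒳 hirr haff hsm hdim habel he p W hW s₀ hs₀
    haveI := hirr
    haveI := haff
    haveI := hsm
    haveI : LocallyOfFiniteType S.hom := inferInstance
    exact WeilTypeLadder.mem_algebraicClasses_of_isOpen_subset_algebraicityLocus f h𝒳
      (IsQuasiProjectiveOver.of_isAffine S) hsm hf W hUo ⟨s₀, hs₀U⟩ hUalg s

/-- Row b02 gives its germ form on one-parameter abelian schemes outright (the open set is the whole base).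
[folklore] -/
theorem abelianSchemeVHCGermCurve_of_abelianSchemeVHC (h : AbelianSchemeVHC) : AbelianSchemeVHCGermCurve[] :=
  fun _ _ _ f hf _ hirr _ hsm _ habel _ p W hW s₀ hs₀ =>
    ⟨Set.univ, isOpen_univ, Set.mem_univ _, fun s _ => h f hf hirr hsm habel p W hW ⟨s₀, hs₀⟩ s⟩

/-- The germ form on one-parameter abelian schemes is implied by the junction's germ form on affine bases of any
dimension (drop the section and the dimension clause) — so (C2′) asks LESS of an engine than
(L2″)/(S2′). [folklore] -/
theorem abelianSchemeVHCGermCurve_of_germAffine (h : AbelianSchemeVHCGermAffine[]) : AbelianSchemeVHCGermCurve[] :=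
  fun _ _ _ f hf h𝒳 hirr haff hsm _ habel _ p W hW s₀ hs₀ => h f hf h𝒳 hirr haff hsm habel p W hW s₀ hs₀

/-- **(C2′) EXACTNESS modulo the curve residual: row b02 `AbelianSchemeVHC` ⟺ local density of algebraic fibres on
one-parameter abelian schemes with quasi-projective total space.** [cite: CharlesSchnell2014Notes, Conj. 11.3.1 and Prop. 11.3.11 (proof)]
[cite: Bloch1972Semiregularity, Thm. 7.4] [cite: BuchweitzFlenner2003, Thm. 5.1] [cite: GortzWedhorn2023, Thm. 27.291] -/
theorem abelianSchemeVHC_iff_germCurve_of_abelianSectionCurveQuasiProjective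
    (hqp : AbelianSectionCurveQuasiProjective[]) : AbelianSchemeVHC ↔ AbelianSchemeVHCGermCurve[] :=
  ⟨abelianSchemeVHCGermCurve_of_abelianSchemeVHC, abelianSchemeVHC_of_germCurve_of_abelianSectionCurveQuasiProjective hqp⟩

/-! ## §3 Part XXVII's printed-carrier node reaches row b02, modulo the curve residual -/

/-- **(C3) `VariationalHodgeQP ⟹ AbelianSchemeVHC` granted only the curve residual.** Reduce to families with a section
over affine curves (C1); there the total space is quasi-projective by the residual, so seat b03's junction (J1)
`Binders.variationalHodge_quasiProjective_of_variationalHodgeQP` concludes.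
[cite: CharlesSchnell2014Notes, Conj. 11.3.1] [cite: GortzWedhorn2023, Thm. 27.291] -/
theorem abelianSchemeVHC_of_variationalHodgeQP_of_abelianSectionCurveQuasiProjective
    (hqp : AbelianSectionCurveQuasiProjective[]) (hV : VariationalHodgeQP) : AbelianSchemeVHC :=
  abelianSchemeVHC_of_sectionCurve fun _ _ _ f hf hirr haff hsm hdim habel he p W hW h₀ s =>
    variationalHodge_quasiProjective_of_variationalHodgeQP hV f hf (hqp f hf hirr haff hsm hdim habel he) hirr hsm p W
      hW h₀ s

/-- (C3, flat-section form) Charles–Schnell's Conj. 11.3.1 on its printed carriers (`FlatSectionsAlgebraicQP`, part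
XXVII) reaches row b02 granted only the curve residual. [cite: CharlesSchnell2014Notes, Conj. 11.3.1, Thm. 11.3.4 and proof of Prop. 11.3.5] -/
theorem abelianSchemeVHC_of_flatSectionsAlgebraicQP_of_abelianSectionCurveQuasiProjective
    (hqp : AbelianSectionCurveQuasiProjective[]) (hF : FlatSectionsAlgebraicQP) : AbelianSchemeVHC :=
  abelianSchemeVHC_of_variationalHodgeQP_of_abelianSectionCurveQuasiProjective hqp
    (variationalHodgeQP_of_flatSectionsAlgebraicQP hF)

/-! ## §4 The target `HC_AV` and one-parameter abelian schemes -/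

/-- **(C4) `HC_AV` ⟺ the variational Hodge statement for ONE-PARAMETER ABELIAN SCHEMES** (families with a section over
smooth irreducible affine curves), modulo André 1996 Lemme 6.3.1 and Lemmes 6.3.2–6.3.3 only: deform IV's (E₂′)
`Deform.HC_AV_iff_abelianSchemeVHC_of_andre1996` composed with (C1′). No `HC_CM`, no residual.
[cite: Andre1996Motifs, §6.3 Lemmes 6.3.1–6.3.3 and Remarque 2 (p. 33)] [cite: CharlesSchnell2014Notes, Cor. 11.3.6]
[cite: MumfordAV1970, §6, Lemma] -/
theorem hc_av_iff_abelianSchemeVHCSectionCurve_of_andre1996 (h₂₁ : andre1996_cmAnchoredPencil)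
    (h₂₂ : andre1996_cmHodgeClasses_algebraicallyAnchoredPencils) :
    Theses.PadicSemiregularLift.HodgeAbelianVarieties ↔ AbelianSchemeVHCSectionCurve[] :=
  (Deform.HC_AV_iff_abelianSchemeVHC_of_andre1996 h₂₁ h₂₂).trans abelianSchemeVHC_iff_sectionCurve

/-! ## Audit

`#print axioms` of every theorem above: `propext`, `Classical.choice`, `Quot.sound` (checked at submission). No
`sorry`, no new `def`/`axiom`/`opaque`. Literature named facts as hypotheses: NONE outside §4, whose single theorem
(C4) `hc_av_iff_abelianSchemeVHCSectionCurve_of_andre1996` displays the two refereed André-1996 facts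
`h₂₁ : andre1996_cmAnchoredPencil` (row c11 of `BINDER-OWNERS.md`) and
`h₂₂ : andre1996_cmHodgeClasses_algebraicallyAnchoredPencils` (row c12) as binders — consumed, never asserted, never
discharged here; §§1–3 are fact-free (Mumford's curve lemma enters as the tree THEOREM
`mumford_smoothCurve_through_two_points_holds`). The displayed inline Props are the forms of row b02 itself, part
XXVII's nodes, and the residuals `AbelianSectionQuasiProjective[]` ⟹ `AbelianSectionCurveQuasiProjective[]`, never
asserted.

Revision 2 (seat ring2-b02, gen 14): DOCSTRING-ONLY — this footer and the matching sentence of the module docstring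
corrected per referee advisory A-84.1 (`pub-hodge-ring2-ref1/REFEREE.md` §87.4: the earlier wording «no Literature named
fact as hypothesis» overlooked §4's displayed `h₂₁`/`h₂₂`); all 13 declarations (statements and proofs) are
byte-identical to revision 1 (p236292).
-/

end Summit.HodgeConjecture.HodgeConjecture.Ring2.Binders

end
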